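import Mathlib
import Summits.Ventures.PercRepro2.Defs
import Summits.Ventures.PercRepro2.Independence
import Summits.Ventures.PercRepro2.Harris
import Summits.Ventures.PercRepro2.CoinDefs
import Summits.Ventures.PercRepro2.CoinArcsOff
import Summits.Ventures.PercRepro2.CoinInduced
import Summits.Ventures.PercRepro2.CoinVdBK
import Summits.Ventures.PercRepro2.CoinReverse
import Summits.Ventures.PercRepro2.CoinPendant
import Summits.Ventures.PercRepro2.CoinPendantDefs
import Summits.Ventures.PercRepro2.CoinTraceLevels
import Summits.Ventures.PercRepro2.CoinStarAlg
import Summits.Ventures.PercRepro2.CoinStarDefs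
import Summits.Ventures.PercRepro2.CoinLsmCoreAlg

/-!
# Closed-in cores: reachability, core levels and the core mass decomposition (blind cell
PercRepro2, night-2 g7; proofs/NIGHT2-DARC.md §30.10)

A CLOSED-IN CORE `C` of the root `s`: every arc into `C` comes from `C ∪ {s}`, nothing enters `s`
(`ClosedInCore`).  Everything else — entries from `C ∪ {s}` into the head, the head, the target
`t` — is an arbitrary mixed system (`SameEnds`).  The forward cluster of `s` meets `C` in a set
`W` (the «core level» `coreLevel`, a functional of the CORE coins = the coins with an arc into
`C`); on that level the markers `1[a ∈ S⁺]`, `1[b ∈ S⁺]` (`a, b ∈ C`) are `1[a ∈ W]`, `1[b ∈ W]`,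
`R_t` is «no vertex of `W ∪ {s}` reaches `t` without the core coins» (`coreAvoidEvent`), and the
gate of `u → w` (`u ∈ C`, `w ∉ C ∪ {s}`) adds `w` to the avoided set when `u ∈ W` (`starTarget`).
The levels are independent of the head (`core_mass`).  This file holds the reachability lemmas of a
closed-in core, the core levels, the two partitions (`avoid_eq_biUnion`, `gate_eq_biUnion`) and
the mass decomposition; `CoinLsmCore.lean` assembles them into `darc_of_lsmCore`.
-/

namespace Summit.Ventures.PercRepro2.Coin

open Classical

section CoreReach

variable {V : Type*} {E : Type*} [DecidableEq V]

omit [DecidableEq V] in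
/-- Reachability in an arc map depends only on the coins carrying an arc of that map. -/
lemma reach_congr_of_agree {D : E → Finset (V × V)} {ω ω' : Config E}
    (h : ∀ e, D e ≠ ∅ → ω e = ω' e) {x y : V} : Reach D ω x y ↔ Reach D ω' x y := by
  have key : ∀ {x y : V}, Reach D ω x y → Reach D ω' x y := by
    intro x y hr
    induction hr with
    | refl => exact reach_refl _ _ _
    | @tail y z _ hstep ih =>
      obtain ⟨e, he, hxy⟩ := hstep
      have hne : D e ≠ ∅ := Finset.ne_empty_of_mem hxy
      exact reach_trans ih (reach_of_openArc ⟨e, (h e hne) ▸ he, hxy⟩)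
  have key' : ∀ {x y : V}, Reach D ω' x y → Reach D ω x y := by
    intro x y hr
    induction hr with
    | refl => exact reach_refl _ _ _
    | @tail y z _ hstep ih =>
      obtain ⟨e, he, hxy⟩ := hstep
      have hne : D e ≠ ∅ := Finset.ne_empty_of_mem hxy
      exact reach_trans ih (reach_of_openArc ⟨e, (h e hne).symm ▸ he, hxy⟩)
  exact ⟨key, key'⟩

/-- A closed-in core: every arc into `C` has its tail in `C ∪ {s}`; no arc enters `s`; `s ∉ C`. -/
structure ClosedInCore (arcs : E → Finset (V × V)) (s : V) (C : Finset V) : Prop where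
  into_C : ∀ e, ∀ xy ∈ arcs e, xy.2 ∈ C → xy.1 ∈ C ∨ xy.1 = s
  into_s : ∀ e, ∀ xy ∈ arcs e, xy.2 ≠ s
  s_notin : s ∉ C

/-- The core coins: the coins with an arc into `C` (the `tailCoins` of the reversed system). -/
def coreCoins (arcs : E → Finset (V × V)) (C : Finset V) : Set E := tailCoins (revArcs arcs) C

/-- The arc map with the core coins switched off. -/
noncomputable def coreOff (arcs : E → Finset (V × V)) (C : Finset V) : E → Finset (V × V) :=
  fun e => if e ∈ coreCoins arcs C then ∅ else arcs e

/-- The head's avoidance event: no vertex of `X ∪ {s}` reaches `t` without the core coins. -/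
def coreAvoidEvent (arcs : E → Finset (V × V)) (s t : V) (C X : Finset V) : Set (Config E) :=
  {ω | ∀ v ∈ insert s X, ¬ Reach (coreOff arcs C) ω v t}

/-- The core level of `W`: the forward cluster of `s` meets `C` exactly in `W`. -/
def coreLevel (arcs : E → Finset (V × V)) (s : V) (C W : Finset V) : Set (Config E) :=
  traceLevel (revArcs arcs) {s} C W

variable {arcs : E → Finset (V × V)} {s : V} {C : Finset V}

/-- Membership in a core level. -/
lemma mem_coreLevel {W : Finset V} {ω : Config E} :
    ω ∈ coreLevel arcs s C W ↔ ∀ z ∈ C, (z ∈ W ↔ Reach arcs ω s z) := by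
  simp only [coreLevel, traceLevel, bwdEvent, Set.mem_setOf_eq, Finset.mem_singleton,
    exists_eq_left, reach_revArcs]

/-- A core coin: some arc of it enters `C`. -/
lemma mem_coreCoins {e : E} : e ∈ coreCoins arcs C ↔ ∃ xy ∈ arcs e, xy.2 ∈ C := by
  simp only [coreCoins, tailCoins, Set.mem_setOf_eq]
  constructor
  · rintro ⟨xy, hxy, hx⟩
    exact ⟨(xy.2, xy.1), mem_revArcs.mp (by simpa using hxy), hx⟩
  · rintro ⟨xy, hxy, hy⟩
    exact ⟨(xy.2, xy.1), mem_revArcs.mpr (by simpa using hxy), hy⟩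

/-- A coin of the reduced map is a coin of the original map. -/
lemma coreOff_subset (e : E) : coreOff arcs C e ⊆ arcs e := by
  simp only [coreOff]
  split_ifs
  · exact Finset.empty_subset _
  · exact le_rfl

/-- Reachability in the reduced map implies reachability in the original map. -/
lemma reach_of_reach_coreOff {ω : Config E} {x y : V} (h : Reach (coreOff arcs C) ω x y) :
    Reach arcs ω x y := by
  induction h with
  | refl => exact reach_refl _ _ _
  | tail _ hstep ih =>
    obtain ⟨e, he, hxy⟩ := hstep
    exact reach_trans ih (reach_of_openArc ⟨e, he, coreOff_subset e hxy⟩)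

/-- The reduced map is `SameEnds` when the original map is. -/
lemma sameEnds_coreOff (hS : SameEnds arcs) : SameEnds (coreOff arcs C) := by
  intro e xy hxy xy' hxy'
  exact hS e xy (coreOff_subset e hxy) xy' (coreOff_subset e hxy')

/-- An arc whose head is outside `C ∪ {s}` is an arc of the reduced map (`SameEnds`: a coin with
an arc into the core has all its endpoints in `C ∪ {s}`). -/
lemma ClosedInCore.mem_coreOff (h : ClosedInCore arcs s C) (hS : SameEnds arcs) {e : E}
    {x y : V} (hxy : (x, y) ∈ arcs e) (hy : y ∉ C) (hys : y ≠ s) : (x, y) ∈ coreOff arcs C e := by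
  simp only [coreOff]
  rw [if_neg]
  · exact hxy
  · intro hmem
    obtain ⟨⟨x', y'⟩, hxy', hy'⟩ := mem_coreCoins.mp hmem
    have hx' : x' ∈ C ∨ x' = s := h.into_C e _ hxy' hy'
    have hends := hS e (x', y') hxy' (x, y) hxy
    have hyin : y = x' ∨ y = y' := hends.2
    rcases hyin with rfl | rfl
    · rcases hx' with hx' | hx'
      · exact hy hx'
      · exact hys hx'
    · exact hy hy'

/-- A path starting outside `C ∪ {s}` stays outside and lives in the reduced map. -/
lemma ClosedInCore.reach_outside (h : ClosedInCore arcs s C) (hS : SameEnds arcs) {ω : Config E}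
    {x y : V} (hx : x ∉ C) (hxs : x ≠ s) (hr : Reach arcs ω x y) :
    y ∉ C ∧ y ≠ s ∧ Reach (coreOff arcs C) ω x y := by
  induction hr with
  | refl => exact ⟨hx, hxs, reach_refl _ _ _⟩
  | @tail y z _ hstep ih =>
    obtain ⟨e, he, hxy⟩ := hstep
    have hzs : z ≠ s := h.into_s e _ hxy
    have hzC : z ∉ C := by
      intro hz
      rcases h.into_C e _ hxy hz with hp | hp
      · exact ih.1 hp
      · exact ih.2.1 hp
    exact ⟨hzC, hzs, reach_trans ih.2.2 (reach_of_openArc ⟨e, he, h.mem_coreOff hS hxy hzC hzs⟩)⟩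

/-- Reachability from `s` to a vertex outside the core: a core vertex (or `s`) reached from `s`,
then a path of the reduced map. -/
lemma ClosedInCore.reach_s_iff (h : ClosedInCore arcs s C) (hS : SameEnds arcs) {ω : Config E}
    {y : V} (hy : y ∉ C) (hys : y ≠ s) :
    Reach arcs ω s y ↔ ∃ v ∈ insert s C, Reach arcs ω s v ∧ Reach (coreOff arcs C) ω v y := by
  constructor
  · intro hr
    have key : ∀ {y : V}, Reach arcs ω s y → (y ∈ C ∨ y = s) ∨
        ((y ∉ C ∧ y ≠ s) ∧ ∃ v ∈ insert s C, Reach arcs ω s v ∧ Reach (coreOff arcs C) ω v y) := by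
      intro y hr
      induction hr with
      | refl => exact Or.inl (Or.inr rfl)
      | @tail y z hsy hstep ih =>
        obtain ⟨e, he, hxy⟩ := hstep
        have hzs : z ≠ s := h.into_s e _ hxy
        by_cases hzC : z ∈ C
        · exact Or.inl (Or.inl hzC)
        · refine Or.inr ⟨⟨hzC, hzs⟩, ?_⟩
          rcases ih with hcore | ⟨_, v, hv, hsv, hvy⟩
          · refine ⟨y, ?_, hsy, reach_of_openArc ⟨e, he, h.mem_coreOff hS hxy hzC hzs⟩⟩
            rcases hcore with hyC | rfl
            · exact Finset.mem_insert_of_mem hyC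
            · exact Finset.mem_insert_self _ _
          · exact ⟨v, hv, hsv,
              reach_trans hvy (reach_of_openArc ⟨e, he, h.mem_coreOff hS hxy hzC hzs⟩)⟩
    rcases key hr with hcore | ⟨_, hex⟩
    · rcases hcore with hyC | rfl
      · exact absurd hyC hy
      · exact absurd rfl hys
    · exact hex
  · rintro ⟨v, _, hsv, hvy⟩
    exact reach_trans hsv (reach_of_reach_coreOff hvy)

/-- `R_t` on a closed-in core (`t ∉ C`, `t ≠ s`): every core vertex reached from `s` — and `s`
itself — fails to reach `t` in the reduced map. -/
lemma ClosedInCore.avoid_iff (h : ClosedInCore arcs s C) (hS : SameEnds arcs) {t : V}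
    (htC : t ∉ C) (hts : t ≠ s) {ω : Config E} :
    ω ∈ avoidEvent arcs s {t} ↔
      ∀ v ∈ insert s C, Reach arcs ω s v → ¬ Reach (coreOff arcs C) ω v t := by
  simp only [avoidEvent, Set.mem_setOf_eq, Finset.mem_singleton, forall_eq]
  rw [h.reach_s_iff hS htC hts]
  constructor
  · intro hh v hv hsv hvt; exact hh ⟨v, hv, hsv, hvt⟩
  · rintro hh ⟨v, hv, hsv, hvt⟩; exact hh v hv hsv hvt

/-- The gate event of `u → w` on a closed-in core (`w ∉ C`, `w ≠ s`): `R_t`, and if `u` is reached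
then `w` does not reach `t` in the reduced map. -/
lemma ClosedInCore.gate_iff (h : ClosedInCore arcs s C) (hS : SameEnds arcs) {t u w : V}
    (hwC : w ∉ C) (hws : w ≠ s) {ω : Config E} :
    ω ∈ gateEvent arcs s {t} u w ↔
      ω ∈ avoidEvent arcs s {t} ∧ (Reach arcs ω s u → ¬ Reach (coreOff arcs C) ω w t) := by
  rw [gateEvent_eq_union]
  simp only [Set.mem_inter_iff, Set.mem_union, Set.mem_compl_iff, fwdEvent, bwdEvent,
    Set.mem_setOf_eq, Finset.mem_singleton, exists_eq_left]
  have hw : Reach arcs ω w t ↔ Reach (coreOff arcs C) ω w t :=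
    ⟨fun hr => (h.reach_outside hS hwC hws hr).2.2, reach_of_reach_coreOff⟩
  rw [hw]
  constructor
  · rintro ⟨hR, hg⟩
    refine ⟨hR, fun hsu hwt => ?_⟩
    rcases hg with hg | hg
    · exact hg hsu
    · exact hg hwt
  · rintro ⟨hR, hg⟩
    refine ⟨hR, ?_⟩
    by_cases hsu : Reach arcs ω s u
    · exact Or.inr (hg hsu)
    · exact Or.inl hsu

/-- In the reversed system the core is closed out into `s`. -/
lemma ClosedInCore.closedOut_rev (h : ClosedInCore arcs s C) : ClosedOut (revArcs arcs) C {s} := by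
  intro e xy hxy hx
  rw [mem_revArcs] at hxy
  rw [Finset.mem_union, Finset.mem_singleton]
  exact h.into_C e _ hxy hx

/-- The core levels depend on the core coins only. -/
lemma ClosedInCore.dependsOn_coreLevel (h : ClosedInCore arcs s C) (W : Finset V) :
    DependsOn (· ∈ coreLevel arcs s C W) (coreCoins arcs C) :=
  dependsOn_traceLevel h.closedOut_rev W

/-- The head's avoidance event depends on the non-core coins only. -/
lemma dependsOn_coreAvoid (t : V) (X : Finset V) :
    DependsOn (· ∈ coreAvoidEvent arcs s t C X) (coreCoins arcs C)ᶜ := by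
  intro ω ω' hh
  have hcongr : ∀ e, coreOff arcs C e ≠ ∅ → ω e = ω' e := by
    intro e he
    apply hh
    intro hmem
    apply he
    simp only [coreOff]
    rw [if_pos hmem]
  simp only [coreAvoidEvent, Set.mem_setOf_eq, eq_iff_iff]
  constructor
  · intro h' v hv hr; exact h' v hv ((reach_congr_of_agree hcongr).mpr hr)
  · intro h' v hv hr; exact h' v hv ((reach_congr_of_agree hcongr).mp hr)

/-- `R_t` is the disjoint union over `W ⊆ C` of «core level `W` and `W ∪ {s}` avoids `t`». -/
theorem ClosedInCore.avoid_eq_biUnion (h : ClosedInCore arcs s C) (hS : SameEnds arcs) {t : V}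
    (htC : t ∉ C) (hts : t ≠ s) :
    avoidEvent arcs s {t} =
      ⋃ W ∈ C.powerset, coreLevel arcs s C W ∩ coreAvoidEvent arcs s t C W := by
  ext ω
  simp only [Set.mem_iUnion, Set.mem_inter_iff, exists_prop, Finset.mem_powerset]
  constructor
  · intro hω
    refine ⟨C.filter (fun v => Reach arcs ω s v), Finset.filter_subset _ _, ?_, ?_⟩
    · rw [mem_coreLevel]
      intro z hz
      simp [Finset.mem_filter, hz]
    · intro v hv
      rw [Finset.mem_insert, Finset.mem_filter] at hv
      rcases hv with rfl | ⟨hvC, hsv⟩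
      · exact (h.avoid_iff hS htC hts).mp hω v (Finset.mem_insert_self _ _) (reach_refl _ _ _)
      · exact (h.avoid_iff hS htC hts).mp hω v (Finset.mem_insert_of_mem hvC) hsv
  · rintro ⟨W, hW, hlev, hav⟩
    rw [h.avoid_iff hS htC hts]
    intro v hv hsv
    rw [Finset.mem_insert] at hv
    rcases hv with rfl | hvC
    · exact hav v (Finset.mem_insert_self _ _)
    · exact hav v (Finset.mem_insert_of_mem ((mem_coreLevel.mp hlev v hvC).mpr hsv))

/-- The gate event of `u → w` is the disjoint union over `W ⊆ C` of «core level `W` and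
`starTarget u w W ∪ {s}` avoids `t`». -/
theorem ClosedInCore.gate_eq_biUnion (h : ClosedInCore arcs s C) (hS : SameEnds arcs)
    {t u w : V} (htC : t ∉ C) (hts : t ≠ s) (hu : u ∈ C) (hwC : w ∉ C) (hws : w ≠ s) :
    gateEvent arcs s {t} u w =
      ⋃ W ∈ C.powerset, coreLevel arcs s C W ∩ coreAvoidEvent arcs s t C (starTarget u w W) := by
  ext ω
  simp only [Set.mem_iUnion, Set.mem_inter_iff, exists_prop, Finset.mem_powerset]
  rw [h.gate_iff hS hwC hws]
  constructor
  · rintro ⟨hR, hg⟩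
    refine ⟨C.filter (fun v => Reach arcs ω s v), Finset.filter_subset _ _, ?_, ?_⟩
    · rw [mem_coreLevel]
      intro z hz
      simp [Finset.mem_filter, hz]
    · intro v hv
      rw [Finset.mem_insert] at hv
      rcases hv with rfl | hv
      · exact (h.avoid_iff hS htC hts).mp hR v (Finset.mem_insert_self _ _) (reach_refl _ _ _)
      · simp only [starTarget] at hv
        split_ifs at hv with huL
        · rw [Finset.mem_insert] at hv
          rcases hv with rfl | hv
          · exact hg (Finset.mem_filter.mp huL).2
          · rw [Finset.mem_filter] at hv
            exact (h.avoid_iff hS htC hts).mp hR v (Finset.mem_insert_of_mem hv.1) hv.2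
        · rw [Finset.mem_filter] at hv
          exact (h.avoid_iff hS htC hts).mp hR v (Finset.mem_insert_of_mem hv.1) hv.2
  · rintro ⟨W, hW, hlev, hav⟩
    have hsub : W ⊆ starTarget u w W := by
      simp only [starTarget]; split_ifs
      · exact Finset.subset_insert _ _
      · exact le_rfl
    refine ⟨?_, ?_⟩
    · rw [h.avoid_iff hS htC hts]
      intro v hv hsv
      rw [Finset.mem_insert] at hv
      rcases hv with rfl | hvC
      · exact hav v (Finset.mem_insert_self _ _)
      · exact hav v (Finset.mem_insert_of_mem (hsub ((mem_coreLevel.mp hlev v hvC).mpr hsv)))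
    · intro hsu
      have huW : u ∈ W := (mem_coreLevel.mp hlev u hu).mpr hsu
      apply hav w
      simp [starTarget, huW]

/-- On the core level of `W` the marker of `a ∈ C` is the constant `1[a ∈ W]`. -/
lemma marker_on_coreLevel {R : Type*} [CommRing R] {W : Finset V} {a : V} (ha : a ∈ C)
    {ω : Config E} (hω : ω ∈ coreLevel arcs s C W) :
    marker (R := R) arcs s a ω = if a ∈ W then 1 else 0 := by
  simp only [marker]
  rw [← mem_coreLevel.mp hω a ha]
  by_cases haW : a ∈ W <;> simp [haW]

end CoreReach

section CoreMass

variable {V : Type*} {E : Type*} [Fintype V] [DecidableEq V] [Fintype E] [DecidableEq E]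
  {R : Type*} [Field R] [LinearOrder R] [IsStrictOrderedRing R]
  {arcs : E → Finset (V × V)} {s : V} {C : Finset V}

omit [Fintype V] [LinearOrder R] [IsStrictOrderedRing R] in
/-- **The core mass decomposition**: for an observable that is the constant `g W` on the core
level of `W`, the mass over `⊔_W (level W ∩ head-avoidance of X W)` is `Σ_W g W · ν W · A (X W)`
with `ν W = P(level W)` and `A X = P(X ∪ {s} ↛ t without the core coins)`. -/
theorem ClosedInCore.core_mass (h : ClosedInCore arcs s C) (p : E → R) (t : V)
    (X : Finset V → Finset V) {f : Config E → R} {g : Finset V → R}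
    (hfg : ∀ W ⊆ C, ∀ ω ∈ coreLevel arcs s C W, f ω = g W) :
    massE p f (⋃ W ∈ C.powerset, coreLevel arcs s C W ∩ coreAvoidEvent arcs s t C (X W)) =
      ∑ W ∈ C.powerset, g W * (prob p (coreLevel arcs s C W) *
        prob p (coreAvoidEvent arcs s t C (X W))) := by
  rw [massE_biUnion p f C.powerset
    (fun W => coreLevel arcs s C W ∩ coreAvoidEvent arcs s t C (X W))
    (by unfold coreLevel; exact pairwiseDisjoint_levels_powerset _)]
  refine Finset.sum_congr rfl fun W hW => ?_
  have hW' : W ⊆ C := Finset.mem_powerset.mp hW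
  rw [massE_congr' p (g := fun _ => g W) (fun ω hω => hfg W hW' ω hω.1), star_massE_const,
    prob_inter_eq_mul_of_dependsOn p disjoint_compl_right (h.dependsOn_coreLevel W)
      (dependsOn_coreAvoid t (X W))]

omit [Fintype V] [Fintype E] [DecidableEq E] [LinearOrder R] [IsStrictOrderedRing R] in
/-- The gate target's avoidance mass splits on `u ∈ W`. -/
lemma starTarget_split (u w : V) (A : Finset V → R) (W : Finset V) :
    A (starTarget u w W) = notMemWt u W * A W + memWt u W * A (insert w W) := by
  simp only [starTarget, notMemWt, memWt]
  split_ifs <;> ring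

end CoreMass

end Summit.Ventures.PercRepro2.Coin
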